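import Summits.QuantumAdvantage.QuantumAdvantage.Theorems.CubicForrelationNearExactIsExactTwelveSecondTypeO
import Summits.QuantumAdvantage.QuantumAdvantage.Theorems.CubicForrelationNearExactIsExactZeroModSixSecondLevelOne
import Summits.QuantumAdvantage.QuantumAdvantage.Theorems.CubicForrelationNearExactIsExactEighteenPairing
import Summits.QuantumAdvantage.QuantumAdvantage.Theorems.CubicForrelationNearExactIsExactThetaLadder
import Summits.QuantumAdvantage.QuantumAdvantage.Theorems.CubicForrelationNearExactIsExactFourteenBoundary

/-!
# Crux `CubicForrelation.NearExactIsExact` (stmt-QuantumAdvantage-14043) — n = 12: the boundary value `Φ = 15/16` is NOT attained —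
  `θ₁₂ ∈ [57/64, 15/16)`

Certificate seat `b2b-cforr-cert` (gen 8).  HONEST FRAMING: a THEOREM about the finite slice `n = 12` of the crux, kernel-checked and
two-sided (partner-using); NOT summit progress.  The tree had `θ₁₂ ∈ [57/64, 15/16]` (`theta_twelve_bounds`: `isolation_twelve_15_16` one-sided,
and `Negative/CapTightTwelve.lean`: the one-sided capacity `15/16` IS attained by a non-bent cubic, so no one-sided argument can close the
boundary).  THEOREM `isolation_twelve_closed`: for all cubic `f, g : 𝔽₂¹² → 𝔽₂`, `Φ(f,g) ≥ 15/16 ⇒ Φ(f,g) = 1`; hence `theta_twelve_halfopen`.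

With `W_g = 16u` (Ax), `s = (−1)^f`, `τ = u − 4s`, budget `Σ τ² = 2¹⁷(1−Φ) ≤ 2¹³` and pairing `Σ (−1)^g τ̂ = 2²⁰(1−Φ)` (the `r = 2` case of the
`n ≡ 0 (mod 6)` second-boundary analysis `…ZeroModSixSecond*.lean`, whose type-O and codimension-3 steps needed `r ≥ 3`):
* type O: `tw12_typeO_false` (`…TwelveSecondTypeO.lean`; the all-cheap class is the tree's `TypeOTwelve.no_caseA`);
* level 5 (`u = 2u'`, some `u'` odd): `z2_levelOne_false` at `r = 2`;
* level 6 (`u = 4u''`): `tw12_levelSix_ge` below — at `r = 2` the budget is paid on the EVEN points of `u''` (`τ = 4(u'' − s)` with `s` odd),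
  so either all `u''` are odd (then `Σu''² = 2¹²` forces `|u''| = 1`: `g` bent, `Φ = 1` or `≤ 7/8` by Hou + Reed–Muller) or `Z = {u'' even}`
  (complement of the cubic parity) is a 9-flat carrying `e = u'' − s = ±1`, `τ = 4e·1_Z`, three transversal directions localise the 6- and 7-flat
  sums to (H3)/(H4), and the engine gives `(Σ|(e1_Z)^|)² ≤ 2²⁶ < (2¹⁴)²` required by the pairing.

References: J. Ax (1964) / R. J. McEliece (1972); X.-D. Hou (1998); MacWilliams–Sloane (1977) Ch. 13–15; R. O'Donnell (2014) §3.3.  Everything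
below is proved from Mathlib and the tree; axioms are the standard three.
-/

set_option linter.dupNamespace false -- D-0017: single-problem summit ⇒ `QuantumAdvantage.QuantumAdvantage` by design

noncomputable section

namespace Summit.QuantumAdvantage.QuantumAdvantage.Theorems.CubicForrelation.NearExactIsExact

open Finset
open Literature.Computability.QuantumComplexity
open Literature.Computability.QuantumComplexity.BuzetChailloux (bxor zeroVec bxor_bxor_cancel_left bxor_zeroVec zeroVec_bxor bxor_comm
  bxor_self)
open Literature.Computability.QuantumComplexity.DerivativeWalsh (W)

/-- **Level `≥ 6` on 12 bits: `Φ ≥ 15/16 ⇒ Φ = 1`.**  For cubic `f, g : 𝔽₂¹² → 𝔽₂` with `W_g = 64·u''` and `Φ(f,g) ≥ 15/16` the pair is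
exact.  Finite-slice statement; NOT summit progress. [this work] -/
theorem tw12_levelSix_ge (f g : (Fin (6 + 6) → Bool) → Bool) (hf : IsDegLeFun 3 f) (hg : IsDegLeFun 3 g)
    (u'' : (Fin (6 + 6) → Bool) → ℤ) (hu'' : ∀ x, W (fun y => signOf (g y)) x = (2 : ℝ) ^ 6 * (u'' x : ℝ))
    (hΦ : (15 / 16 : ℝ) ≤ forrelation f g) : forrelation f g = 1 := by
  classical
  -- `u = 4u''` at the Ax level `4`
  set u : (Fin (6 + 6) → Bool) → ℤ := fun x => 4 * u'' x with hudef
  have hu : ∀ x, W (fun y => signOf (g y)) x = (2 : ℝ) ^ 4 * (u x : ℝ) := by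
    intro x; rw [hu'' x]; simp only [u]; push_cast; ring
  -- budget `Σ (u'' − s)² ≤ 512`
  have hbud := tw12_budget f g u hu
  have hB : (∑ x, (u'' x - sZ (f x)) ^ 2 : ℤ) ≤ 512 := by
    have h16 : ∀ x, (u x - 4 * sZ (f x)) ^ 2 = 16 * (u'' x - sZ (f x)) ^ 2 := fun x => by simp only [u]; ring
    have h' : ((∑ x, (u x - 4 * sZ (f x)) ^ 2 : ℤ) : ℝ) ≤ 8192 := by rw [hbud]; nlinarith
    have h'' : (∑ x, (u x - 4 * sZ (f x)) ^ 2 : ℤ) ≤ 8192 := by exact_mod_cast h'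
    rw [sum_congr rfl fun x _ => h16 x, ← mul_sum] at h''
    linarith
  -- even points of `u''` cost `≥ 1`
  set Z := univ.filter (fun x : Fin (6 + 6) → Bool => ¬ Odd (u'' x)) with hZdef
  have hmemZ : ∀ x, x ∈ Z ↔ ¬ Odd (u'' x) := fun x => by simp [hZdef]
  have hsumZ : (∑ x, (if ¬ Odd (u'' x) then 1 else 0 : ℤ)) = #Z := by rw [sum_boole]
  have hnonneg : ∀ x, 0 ≤ (u'' x - sZ (f x)) ^ 2 - (if ¬ Odd (u'' x) then 1 else 0 : ℤ) := by
    intro x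
    by_cases h : Odd (u'' x)
    · rw [if_neg (not_not.2 h)]; have := sq_nonneg (u'' x - sZ (f x)); linarith
    · rw [if_pos h]
      have hev := Int.not_odd_iff_even.1 h
      have hodd' : Odd (u'' x - sZ (f x)) := by
        rcases tp_sZ_cases (f x) with hs | hs <;> rw [hs]
        · exact Int.odd_sub.2 (iff_of_false h (by decide))
        · exact Int.odd_sub.2 (iff_of_false h (by decide))
      have h0 := Int.odd_iff.1 hodd'
      have : u'' x - sZ (f x) ≤ -1 ∨ 1 ≤ u'' x - sZ (f x) := by omega
      have := tp_sq_ge (k := 1) (by norm_num) this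
      linarith
  have hZle : (#Z : ℤ) ≤ 512 := by
    rw [← hsumZ]
    exact le_trans (sum_le_sum fun x _ => by have := hnonneg x; linarith) hB
  -- Parseval at level 6: `Σ u''² = 4096`
  have hpar : ∑ x, u'' x ^ 2 = 4096 := by
    have h := zms_sum_u_sq 2 g u (fun x => (hu x).trans (by norm_num))
    have e : ∑ x, ((u x : ℝ)) ^ 2 = 16 * ∑ x, ((u'' x : ℝ)) ^ 2 := by
      rw [mul_sum]; exact sum_congr rfl fun x _ => by simp only [u]; push_cast; ring
    rw [e] at h
    norm_num at h
    have h' : ∑ x, ((u'' x : ℝ)) ^ 2 = 4096 := by linarith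
    exact_mod_cast h'
  by_cases hall : ∀ x, Odd (u'' x)
  · -- every `u''` odd: `g` is bent
    have hsq1 : ∀ x, u'' x ^ 2 = 1 := by
      have hge : ∀ x, (1 : ℤ) ≤ u'' x ^ 2 := fun x => by
        have h0 := Int.odd_iff.1 (hall x)
        have : u'' x ≤ -1 ∨ 1 ≤ u'' x := by omega
        have := tp_sq_ge (k := 1) (by norm_num) this
        linarith
      have hsum0 : ∑ x, (u'' x ^ 2 - 1 : ℤ) = 0 := by
        rw [sum_sub_distrib, hpar, sum_const, card_univ, Fintype.card_fun, Fintype.card_bool, Fintype.card_fin]; norm_num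
      intro x
      have := (sum_eq_zero_iff_of_nonneg fun y _ => by have := hge y; linarith).1 hsum0 x (mem_univ x)
      linarith
    have hbent : ∀ x, W (fun y => signOf (g y)) x ^ 2 = (2 : ℝ) ^ (6 + 6) := by
      intro x
      rw [hu'' x, mul_pow]
      have : ((u'' x : ℝ)) ^ 2 = 1 := by exact_mod_cast hsq1 x
      rw [this]; norm_num
    rcases tw_bent_end (by norm_num) f g hf hg hbent with h | h
    · exact h
    · exfalso; norm_num at h; linarith
  exfalso
  push Not at hall
  obtain ⟨x₁, hx₁⟩ := hall
  -- the parity of `u''` is cubic, so `Z` (non-empty) has `≥ 512` points: everything is tight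
  have hp : IsDegLeFun 3 (fun x => decide (Odd (u'' x))) :=
    stub_walshTower stub_axParity (6 + 6) 6 3 g u'' hg hu'' (by intro k hk hkn; omega)
  have hp' : IsDegLeFun (2 + 1) (fun x => decide (Odd (u'' x)) ^^ true) := tb_isDegLeFun_xor_const hp true
  have hfilt : (univ.filter fun x : Fin (6 + 6) → Bool => (decide (Odd (u'' x)) ^^ true) = true) = Z :=
    filter_congr fun x _ => by simp
  have hRM := bb_rmWeight_holds (6 + 6) 3 (fun x => decide (Odd (u'' x)) ^^ true) hp' ⟨x₁, by simpa using hx₁⟩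
  rw [hfilt] at hRM
  have hZge : 512 ≤ #Z := by norm_num at hRM; omega
  have hZcard : #Z = 512 := by
    have : #Z ≤ 512 := by exact_mod_cast hZle
    omega
  have hsum0 : ∑ x, ((u'' x - sZ (f x)) ^ 2 - (if ¬ Odd (u'' x) then 1 else 0 : ℤ)) = 0 := by
    refine le_antisymm ?_ (sum_nonneg fun x _ => hnonneg x)
    rw [sum_sub_distrib, hsumZ, hZcard]
    push_cast
    linarith
  have hzero' : ∀ x, (u'' x - sZ (f x)) ^ 2 - (if ¬ Odd (u'' x) then 1 else 0 : ℤ) = 0 :=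
    fun x => (sum_eq_zero_iff_of_nonneg fun y _ => hnonneg y).1 hsum0 x (mem_univ x)
  have hoff : ∀ x, Odd (u'' x) → u'' x - sZ (f x) = 0 := by
    intro x hx
    have h := hzero' x
    rw [if_neg (not_not.2 hx), sub_zero] at h
    exact (pow_eq_zero_iff two_ne_zero).1 h
  have hon : ∀ x, ¬ Odd (u'' x) → u'' x - sZ (f x) = 1 ∨ u'' x - sZ (f x) = -1 := by
    intro x hx
    have h := hzero' x
    rw [if_pos hx] at h
    have h1 : (u'' x - sZ (f x)) * (u'' x - sZ (f x)) = 1 := by rw [← pow_two]; linarith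
    exact mul_self_eq_one_iff.1 h1
  have hΦeq : forrelation f g = 15 / 16 := by
    have hT : (∑ x, (u x - 4 * sZ (f x)) ^ 2 : ℤ) = 8192 := by
      have h16 : ∀ x, (u x - 4 * sZ (f x)) ^ 2 = 16 * ((u'' x - sZ (f x)) ^ 2 - (if ¬ Odd (u'' x) then 1 else 0 : ℤ)) +
          16 * (if ¬ Odd (u'' x) then 1 else 0 : ℤ) := fun x => by simp only [u]; ring
      rw [sum_congr rfl fun x _ => h16 x, sum_add_distrib, ← mul_sum, ← mul_sum, hsum0, hsumZ, hZcard]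
      norm_num
    have h : ((∑ x, (u x - 4 * sZ (f x)) ^ 2 : ℤ) : ℝ) = 8192 := by exact_mod_cast hT
    rw [hbud] at h
    linarith
  -- `Z` is a 9-flat
  have hmw := mw_flat_of_minweight 2 (fun x => decide (Odd (u'' x)) ^^ true) hp' (by rw [hfilt, hZcard]; norm_num)
  rw [hfilt] at hmw
  obtain ⟨h0, hadd, hcardV, hcoset⟩ := hmw
  set V₀ := univ.filter (fun a : Fin (6 + 6) → Bool => ∀ x,
    (decide (Odd (u'' (bxor x a))) ^^ true) = (decide (Odd (u'' x)) ^^ true)) with hV₀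
  obtain ⟨xZ, hxZ⟩ : Z.Nonempty := card_pos.1 (by rw [hZcard]; norm_num)
  have hS : Z = V₀.image (bxor xZ) := hcoset xZ (by have h := (hmemZ xZ).1 hxZ; simpa using h)
  rw [hZcard] at hcardV
  -- three transversal directions
  obtain ⟨t₁, -, t₂, -, t₃, -, n1, n2, n21, n3, n31, n32, n321⟩ := ep_dirs3 univ V₀ (by
    rw [hcardV, card_univ, Fintype.card_fun, Fintype.card_bool, Fintype.card_fin]; norm_num)
  -- the sign pattern and the vanishing of the residual off `Z`
  set e : (Fin (6 + 6) → Bool) → ℤ := fun x => u'' x - sZ (f x) with hedef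
  have he : ∀ x ∈ Z, e x = 1 ∨ e x = -1 := fun x hx => hon x ((hmemZ x).1 hx)
  have hF0 : ∀ y, y ∉ Z → u y - 4 * sZ (f y) = 0 := by
    intro y hy
    have := hoff y (not_not.1 fun h => hy ((hmemZ y).2 h))
    simp only [u]; linarith
  have hFe : ∀ y, u y - 4 * sZ (f y) = 4 * e y := fun y => by simp only [u, e]; ring
  have hPV : ∀ x, x ∈ Z → ∀ a ∈ V₀, bxor x a ∈ Z := fun x hx a ha => fl1_coset_vadd hadd hS hx ha
  have hz : ∀ p ∈ Z, ∀ w, w ∉ V₀ → u (bxor p w) - 4 * sZ (f (bxor p w)) = 0 :=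
    fun p hp w hw => hF0 _ (fl1_coset_out h0 hadd hS hp hw)
  have hloc : ∀ {k : ℕ} (x : Fin (6 + 6) → Bool) (a : Fin k → Fin (6 + 6) → Bool),
      (∀ ε : Fin k → Bool, (fun j => x j ^^ decide (Odd #(univ.filter fun i => ε i && a i j))) ∈ Z) →
      ∑ ε : Fin (k + 3) → Bool, (u (fun j => x j ^^ decide (Odd #(univ.filter fun i =>
          ε i && (Matrix.vecCons t₁ (Matrix.vecCons t₂ (Matrix.vecCons t₃ a)) : Fin (k + 3) → Fin (6 + 6) → Bool) i j))) -
        4 * sZ (f (fun j => x j ^^ decide (Odd #(univ.filter fun i =>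
          ε i && (Matrix.vecCons t₁ (Matrix.vecCons t₂ (Matrix.vecCons t₃ a)) : Fin (k + 3) → Fin (6 + 6) → Bool) i j))))) =
      ∑ ε : Fin k → Bool, 4 * e (fun j => x j ^^ decide (Odd #(univ.filter fun i => ε i && a i j))) := by
    intro k x a hin
    have key := ep_loc3 (fun y => u y - 4 * sZ (f y)) x t₁ t₂ t₃ a
      (fun ε => hz _ (hin ε) t₁ n1) (fun ε => hz _ (hin ε) t₂ n2)
      (fun ε => by rw [iw_bxor_assoc]; exact hz _ (hin ε) _ n21)
      (fun ε => hz _ (hin ε) t₃ n3)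
      (fun ε => by rw [iw_bxor_assoc]; exact hz _ (hin ε) _ n31)
      (fun ε => by rw [iw_bxor_assoc]; exact hz _ (hin ε) _ n32)
      (fun ε => by rw [iw_bxor_assoc, iw_bxor_assoc]; exact hz _ (hin ε) _ n321)
    beta_reduce at key
    rw [key]
    exact sum_congr rfl fun ε _ => hFe _
  -- (H3) and (H4)
  have H3 : ∀ x ∈ Z, ∀ a b c : Fin (6 + 6) → Bool, a ∈ V₀ → b ∈ V₀ → c ∈ V₀ →
      (4 : ℤ) ∣ ∑ ε : Fin 3 → Bool, e (fun j => x j ^^ decide (Odd #(univ.filter fun i =>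
        ε i && (![a, b, c] : Fin 3 → Fin (6 + 6) → Bool) i j))) := by
    intro x hx a b c ha hb hc
    have hin : ∀ ε : Fin 3 → Bool, (fun j => x j ^^ decide (Odd #(univ.filter fun i =>
        ε i && (![a, b, c] : Fin 3 → Fin (6 + 6) → Bool) i j))) ∈ Z :=
      fun ε => fr_mem_flatPt3 V₀ h0 (· ∈ Z) hPV hx ![a, b, c] (fun i => by fin_cases i <;> assumption) ε
    have h16 := fs_flat_sum_dvd (e := 4) g u hg hu x ![t₁, t₂, t₃, a, b, c] (by norm_num)
    obtain ⟨zf, hzf⟩ := sl_sum_sZ_flat f hf x ![t₁, t₂, t₃, a, b, c]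
    have hzf' : ∑ ε : Fin 6 → Bool, 4 * sZ (f (fun j => x j ^^ decide (Odd #(univ.filter fun i =>
          ε i && (![t₁, t₂, t₃, a, b, c] : Fin 6 → Fin (6 + 6) → Bool) i j)))) = 16 * zf := by
      rw [← mul_sum, hzf]; norm_num; ring
    have h16n : (16 : ℤ) ∣ ∑ ε : Fin 6 → Bool, u (fun j => x j ^^ decide (Odd #(univ.filter fun i =>
          ε i && (![t₁, t₂, t₃, a, b, c] : Fin 6 → Fin (6 + 6) → Bool) i j))) := by
      have e16 : (2 : ℤ) ^ 4 = 16 := by norm_num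
      rw [e16] at h16; exact h16
    have h16' : (16 : ℤ) ∣ ∑ ε : Fin 6 → Bool, (u (fun j => x j ^^ decide (Odd #(univ.filter fun i =>
          ε i && (![t₁, t₂, t₃, a, b, c] : Fin 6 → Fin (6 + 6) → Bool) i j))) -
        4 * sZ (f (fun j => x j ^^ decide (Odd #(univ.filter fun i =>
          ε i && (![t₁, t₂, t₃, a, b, c] : Fin 6 → Fin (6 + 6) → Bool) i j))))) := by
      rw [sum_sub_distrib, hzf']
      exact dvd_sub h16n (Dvd.intro _ rfl)
    rw [hloc x ![a, b, c] hin, ← mul_sum] at h16'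
    obtain ⟨k16, hk16⟩ := h16'
    exact ⟨k16, by linarith⟩
  have H4 : ∀ x ∈ Z, ∀ a₀ a₁ a₂ a₃ : Fin (6 + 6) → Bool, a₀ ∈ V₀ → a₁ ∈ V₀ → a₂ ∈ V₀ → a₃ ∈ V₀ →
      (8 : ℤ) ∣ ∑ ε : Fin 4 → Bool, e (fun j => x j ^^ decide (Odd #(univ.filter fun i =>
        ε i && (![a₀, a₁, a₂, a₃] : Fin 4 → Fin (6 + 6) → Bool) i j))) := by
    intro x hx a₀ a₁ a₂ a₃ ha₀ ha₁ ha₂ ha₃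
    have hin : ∀ ε : Fin 4 → Bool, (fun j => x j ^^ decide (Odd #(univ.filter fun i =>
        ε i && (![a₀, a₁, a₂, a₃] : Fin 4 → Fin (6 + 6) → Bool) i j))) ∈ Z :=
      fun ε => fr_mem_flatPt4 V₀ h0 (· ∈ Z) hPV hx ![a₀, a₁, a₂, a₃] (fun i => by fin_cases i <;> assumption) ε
    have h32 := fs_flat_sum_dvd (e := 5) g u hg hu x ![t₁, t₂, t₃, a₀, a₁, a₂, a₃] (by norm_num)
    obtain ⟨zf, hzf⟩ := sl_sum_sZ_flat f hf x ![t₁, t₂, t₃, a₀, a₁, a₂, a₃]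
    have hzf' : ∑ ε : Fin 7 → Bool, 4 * sZ (f (fun j => x j ^^ decide (Odd #(univ.filter fun i =>
          ε i && (![t₁, t₂, t₃, a₀, a₁, a₂, a₃] : Fin 7 → Fin (6 + 6) → Bool) i j)))) = 32 * zf := by
      rw [← mul_sum, hzf]; norm_num; ring
    have h32n : (32 : ℤ) ∣ ∑ ε : Fin 7 → Bool, u (fun j => x j ^^ decide (Odd #(univ.filter fun i =>
          ε i && (![t₁, t₂, t₃, a₀, a₁, a₂, a₃] : Fin 7 → Fin (6 + 6) → Bool) i j))) := by
      have e32 : (2 : ℤ) ^ 5 = 32 := by norm_num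
      rw [e32] at h32; exact h32
    have h32' : (32 : ℤ) ∣ ∑ ε : Fin 7 → Bool, (u (fun j => x j ^^ decide (Odd #(univ.filter fun i =>
          ε i && (![t₁, t₂, t₃, a₀, a₁, a₂, a₃] : Fin 7 → Fin (6 + 6) → Bool) i j))) -
        4 * sZ (f (fun j => x j ^^ decide (Odd #(univ.filter fun i =>
          ε i && (![t₁, t₂, t₃, a₀, a₁, a₂, a₃] : Fin 7 → Fin (6 + 6) → Bool) i j))))) := by
      rw [sum_sub_distrib, hzf']
      exact dvd_sub h32n (Dvd.intro _ rfl)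
    rw [hloc x ![a₀, a₁, a₂, a₃] hin, ← mul_sum] at h32'
    obtain ⟨k32, hk32⟩ := h32'
    exact ⟨k32, by linarith⟩
  -- the engine and the pairing
  have hE := fl1_flat_l1 V₀ Z xZ h0 hadd hS e he H3 H4
  set A : (Fin (6 + 6) → Bool) → ℝ := fun x => if x ∈ Z then (e x : ℝ) else 0 with hA
  have hAτ : (fun x => (u x : ℝ) - 4 * signOf (f x)) = fun x => 4 * A x := by
    funext x
    have h2 : (u x : ℝ) - 4 * signOf (f x) = (((u x - 4 * sZ (f x) : ℤ)) : ℝ) := by push_cast; rw [tp_sZ_cast]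
    rw [h2]
    by_cases hx : x ∈ Z
    · simp only [A, if_pos hx]; rw [hFe x]; push_cast; ring
    · simp only [A, if_neg hx]; rw [hF0 x hx]; norm_num
  have hpair := tw12_pairing f g u hu
  rw [hΦeq, hAτ] at hpair
  have hpair' : ∑ y, signOf (g y) * W A y = 16384 := by
    have e2 : ∀ y, signOf (g y) * W (fun x => 4 * A x) y = 4 * (signOf (g y) * W A y) := fun y => by
      rw [fl1_W_smul]; ring
    have h20 : (2 : ℝ) ^ 20 * (1 - 15 / 16) = 4 * 16384 := by norm_num
    rw [sum_congr rfl fun y _ => e2 y, ← mul_sum, h20] at hpair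
    linarith
  have hge : (16384 : ℝ) ≤ ∑ y, |W A y| := by rw [← hpair']; exact fl1_pairing_le_l1 g (W A)
  have hsq : (16384 : ℝ) ^ 2 ≤ (∑ y, |W A y|) ^ 2 := pow_le_pow_left₀ (by positivity) hge 2
  norm_num at hE hsq
  linarith

/-- **`Φ ≥ 15/16 ⇒ Φ = 1` for cubic pairs on `6 + 6` bits.**  Type O: `tw12_typeO_false`; level 5: `z2_levelOne_false` (`r = 2`); level `≥ 6`:
`tw12_levelSix_ge`.  NOT summit progress. [this work] -/
theorem tw12_isolation_ge (f g : (Fin (6 + 6) → Bool) → Bool) (hf : IsDegLeFun 3 f) (hg : IsDegLeFun 3 g)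
    (hΦ : (15 / 16 : ℝ) ≤ forrelation f g) : forrelation f g = 1 := by
  obtain ⟨u, hu⟩ := tw_base g hg 4 (by norm_num)
  by_cases hodd : ∃ x, Odd (u x)
  · obtain ⟨x₀, hx₀⟩ := hodd
    have hdeg := stub_walshTower stub_axParity (6 + 6) 4 0 g u hg hu (by intro k hk hkn; omega)
    have hall : ∀ x, Odd (u x) := by
      intro x
      have hc := tc_const_of_deg_zero hdeg x x₀
      rw [decide_eq_true hx₀] at hc
      exact of_decide_eq_true hc
    exact (tw12_typeO_false f g hf hg u hu hall hΦ).elim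
  · push Not at hodd
    have hu1 := tw_level_up g u hu hodd
    by_cases hodd1 : ∃ x, Odd (u x / 2)
    · have hu1' : ∀ x, W (fun y => signOf (g y)) x = (2 : ℝ) ^ (2 * 2 + 1) * (((u x / 2 : ℤ)) : ℝ) :=
        fun x => (hu1 x).trans (by norm_num)
      have hΦ' : 1 - (1 / 2 : ℝ) ^ (2 * 2) ≤ forrelation f g := by norm_num; linarith
      exact (z2_levelOne_false 2 le_rfl f g hf hg _ hu1' hodd1 hΦ').elim
    · push Not at hodd1
      have hu2 := tw_level_up g _ hu1 hodd1
      exact tw12_levelSix_ge f g hf hg (fun x => u x / 2 / 2) (fun x => (hu2 x).trans (by norm_num)) hΦ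

/-- **On 12 bits, `Φ ≥ 15/16 ⇒ Φ = 1`** for all cubic `f, g : 𝔽₂¹² → 𝔽₂ (at the literal type `Fin 12`).  The boundary value of
`isolation_twelve_15_16` is NOT attained; a kernel-checked, two-sided, decidable verdict about the finite slice `n = 12`; NOT summit progress.
[this work] -/
theorem isolation_twelve_closed : ∀ f g : (Fin 12 → Bool) → Bool, IsDegLeFun 3 f → IsDegLeFun 3 g →
    (15 / 16 : ℝ) ≤ forrelation f g → forrelation f g = 1 :=
  fun f g hf hg h => tw12_isolation_ge f g hf hg h

/-- **`θ₁₂ < 15/16`.** NOT summit progress. [this work] -/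
theorem theta_twelve_lt : ∃ θ : ℝ, θ < 15 / 16 ∧ ∀ f g : (Fin 12 → Bool) → Bool, IsDegLeFun 3 f → IsDegLeFun 3 g →
    θ < forrelation f g → forrelation f g = 1 :=
  fb_theta_lt_of_closed (n := 12) _ isolation_twelve_closed

/-- **`θ₁₂ ∈ [57/64, 15/16)`** (the tree had `[57/64, 15/16]`, `theta_twelve_bounds`). NOT summit progress. [this work] -/
theorem theta_twelve_halfopen : ∃ θ₀ : ℝ, 57 / 64 ≤ θ₀ ∧ θ₀ < 15 / 16 ∧
    IsLeast {θ : ℝ | ∀ f g : (Fin 12 → Bool) → Bool, IsDegLeFun 3 f → IsDegLeFun 3 g →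
      θ < forrelation f g → forrelation f g = 1} θ₀ := by
  obtain ⟨θ₀, hθ₀⟩ := theta_exists 12
  obtain ⟨θ', hθ', hiso⟩ := theta_twelve_lt
  exact ⟨θ₀, theta_twelve_bounds.2 θ₀ hθ₀.1, lt_of_le_of_lt (hθ₀.2 hiso) hθ', hθ₀⟩

end Summit.QuantumAdvantage.QuantumAdvantage.Theorems.CubicForrelation.NearExactIsExact

end
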